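import Mathlib.Analysis.Meromorphic.Divisor
import Mathlib.Analysis.Complex.Convex
import Literature.Analysis.Complex.RectangleCauchyFormula
import HarnessLib

/-!
# The argument principle on a rectangle

Trunk T-ANALYSIS support (complex analysis, `Literature/Analysis/Complex`). Mathlib (this tree's pin)
has the Cauchy–Goursat theorem for rectangles
(`Complex.integral_boundary_rect_eq_zero_of_differentiableOn`), analytic and meromorphic orders and
divisors, but no form of the argument principle. This file proves it for functions analytic on a
closed rectangle, in the four-term boundary convention of Mathlib (bottom − top + i·right − i·left,
as in `Literature.Analysis.Complex.integral_boundary_rect_inv_sub`; here packaged as `Literature.Analysis.Complex.rectBoundaryIntegral`):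

* `Literature.Analysis.Complex.integral_logDeriv_horizontal`, `Literature.Analysis.Complex.integral_logDeriv_vertical` — on an edge
  along which `g` takes values in the slit plane, `∫ g'/g` is the difference of the principal
  logarithms of `g` at the end points (so its imaginary part, the variation of the argument, is
  less than `π` in absolute value);
* `Literature.Analysis.Complex.integral_boundary_rect_logDeriv_eq_zero_of_mem_slitPlane`,
  `Literature.Analysis.Complex.integral_boundary_rect_logDeriv_eq_zero_of_re_neg` — hence `∮_{∂R} g'/g = 0`
  when `g(∂R) ⊆ ℂ ∖ (-∞, 0]`, resp. when `Re g < 0` on `∂R`: the change of argument is zero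
  (the form used by Levinson–Montgomery, Acta Math. 133 (1974), §2);
* `Literature.Analysis.Complex.integral_boundary_rect_logDeriv` — **the argument principle**: for `f` analytic on
  a neighbourhood of every point of the closed rectangle `R = [a,b] × [c,d]` and non-zero on `∂R`,
  `∮_{∂R} f'/f = 2πi · Σ_{ρ ∈ R°, f(ρ)=0} m(ρ)`, the zeros counted with multiplicity
  `m(ρ) = meromorphicOrderAt f ρ` (finitely many: `Literature.Analysis.Complex.finite_zeros_reProdIm`);
  `Literature.Analysis.Complex.rectBoundaryIntegral_logDeriv_eq_sum` is the inductive form over any finite set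
  `S ⊆ R°` containing the zeros.

Proof of the last: induction on the finite set of zeros. If `f` has no zeros on `R`, `f'/f` is
holomorphic on `R` and Cauchy–Goursat applies. Otherwise divide out one zero:
`f = (z-ρ)^{m} f₁` with `f₁ = f/(z-ρ)^m` extended analytically at `ρ` (`m = analyticOrderNatAt f ρ`),
so `f'/f = m/(z-ρ) + f₁'/f₁` on `∂R`, `∮ dz/(z-ρ) = 2πi` for interior `ρ`
(`integral_boundary_rect_inv_sub`), and the orders of `f` and `f₁` agree away from `ρ`.
Textbook statement: Conway, *Functions of One Complex Variable I*, V.3.4 (Argument Principle) for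
the rectangle contour (winding number `1` about interior points); Titchmarsh, *Theory of
Functions*, §3.41.

## References

* J. B. Conway, *Functions of One Complex Variable I*, 2nd ed., GTM 11, Springer 1978, Ch. V §3,
  Thm. 3.4 (Argument Principle).
* E. C. Titchmarsh, *The Theory of Functions*, 2nd ed., OUP 1939, §3.41–3.42.
* N. Levinson, H. L. Montgomery, *Zeros of the derivatives of the Riemann zeta-function*, Acta
  Math. 133 (1974), 49–65, §2 (use of the zero change of argument when `Re ζ'/ζ < 0`).
-/

noncomputable section

open Complex Set MeasureTheory Filter Topology intervalIntegral

namespace Literature.Analysis.Complex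

variable {a b c d : ℝ}

/-! ### Exact logarithmic derivatives along the edges -/

/-- Chain rule along a horizontal line: if `g` is analytic at `x + yi` then
`t ↦ log g(t + yi)` has derivative `g'(x+yi)/g(x+yi)` at `t = x`, provided `g(x+yi)` is in the
slit plane. [folklore] -/
lemma hasDerivAt_log_comp_horizontal {g : ℂ → ℂ} {x y : ℝ} (hg : AnalyticAt ℂ g (x + y * I))
    (hs : g (x + y * I) ∈ slitPlane) :
    HasDerivAt (fun t : ℝ ↦ log (g (t + y * I))) (deriv g (x + y * I) / g (x + y * I)) x := by
  have h1 : HasDerivAt (fun w : ℂ ↦ w + y * I) 1 (x : ℂ) := (hasDerivAt_id (x : ℂ)).add_const _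
  have h2 : HasDerivAt (fun w : ℂ ↦ g (w + y * I)) (deriv g (x + y * I) * 1) (x : ℂ) :=
    HasDerivAt.comp (x : ℂ) hg.differentiableAt.hasDerivAt h1
  have h3 := h2.clog hs
  rw [mul_one] at h3
  exact h3.comp_ofReal

/-- Chain rule along a vertical line: if `g` is analytic at `x + yi` then `t ↦ log g(x + ti)` has
derivative `i · g'(x+yi)/g(x+yi)` at `t = y`, provided `g(x+yi)` is in the slit plane. [folklore] -/
lemma hasDerivAt_log_comp_vertical {g : ℂ → ℂ} {x y : ℝ} (hg : AnalyticAt ℂ g (x + y * I))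
    (hs : g (x + y * I) ∈ slitPlane) :
    HasDerivAt (fun t : ℝ ↦ log (g (x + t * I))) (I * (deriv g (x + y * I) / g (x + y * I))) y := by
  have h1 : HasDerivAt (fun w : ℂ ↦ (x : ℂ) + w * I) (1 * I) (y : ℂ) :=
    ((hasDerivAt_id (y : ℂ)).mul_const I).const_add _
  have h2 : HasDerivAt (fun w : ℂ ↦ g (x + w * I)) (deriv g (x + y * I) * (1 * I)) (y : ℂ) :=
    HasDerivAt.comp (y : ℂ) hg.differentiableAt.hasDerivAt h1
  have h3 := h2.clog hs
  have h4 := h3.comp_ofReal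
  convert h4 using 1
  ring

/-- **Exact form on a horizontal edge.** If `g` is analytic at every point `x + yi`, `a ≤ x ≤ b`,
and takes values in the slit plane `ℂ ∖ (-∞, 0]` there, then
`∫_a^b g'(x+yi)/g(x+yi) dx = log g(b+yi) − log g(a+yi)` (principal logarithm; in particular the
variation of `arg g` along the edge is `< π` in absolute value). [folklore] -/
theorem integral_logDeriv_horizontal {g : ℂ → ℂ} (y : ℝ) (hab : a ≤ b)
    (hg : ∀ x ∈ Icc a b, AnalyticAt ℂ g (x + y * I))
    (hs : ∀ x ∈ Icc a b, g (x + y * I) ∈ slitPlane) :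
    ∫ x : ℝ in a..b, deriv g (x + y * I) / g (x + y * I) =
      log (g (b + y * I)) - log (g (a + y * I)) := by
  have hderiv : ∀ x ∈ Icc a b, HasDerivAt (fun t : ℝ ↦ log (g (t + y * I)))
      (deriv g (x + y * I) / g (x + y * I)) x := fun x hx ↦
    hasDerivAt_log_comp_horizontal (hg x hx) (hs x hx)
  have hcont : ContinuousOn (fun x : ℝ ↦ deriv g (x + y * I) / g (x + y * I)) (Icc a b) := by
    intro x hx
    have h1 : ContinuousAt (fun x : ℝ ↦ (x : ℂ) + y * I) x := by fun_prop
    have h2 : ContinuousAt (deriv g) ((x : ℂ) + y * I) := (hg x hx).deriv.continuousAt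
    have h3 : ContinuousAt g ((x : ℂ) + y * I) := (hg x hx).continuousAt
    exact ((h2.comp (f := fun x : ℝ ↦ (x : ℂ) + y * I) h1).div
      (h3.comp (f := fun x : ℝ ↦ (x : ℂ) + y * I) h1)
      (slitPlane_ne_zero (hs x hx))).continuousWithinAt
  refine integral_eq_sub_of_hasDerivAt_of_le hab ?_ (fun x hx ↦ hderiv x (Ioo_subset_Icc_self hx))
    (hcont.intervalIntegrable_of_Icc hab)
  exact fun x hx ↦ (hderiv x hx).continuousAt.continuousWithinAt

/-- **Exact form on a vertical edge.** If `g` is analytic at every point `x + yi`, `c ≤ y ≤ d`,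
and takes values in the slit plane there, then
`i ∫_c^d g'(x+yi)/g(x+yi) dy = log g(x+di) − log g(x+ci)`. [folklore] -/
theorem integral_logDeriv_vertical {g : ℂ → ℂ} (x : ℝ) (hcd : c ≤ d)
    (hg : ∀ y ∈ Icc c d, AnalyticAt ℂ g (x + y * I))
    (hs : ∀ y ∈ Icc c d, g (x + y * I) ∈ slitPlane) :
    I * ∫ y : ℝ in c..d, deriv g (x + y * I) / g (x + y * I) =
      log (g (x + d * I)) - log (g (x + c * I)) := by
  have hderiv : ∀ y ∈ Icc c d, HasDerivAt (fun t : ℝ ↦ log (g (x + t * I)))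
      (I * (deriv g (x + y * I) / g (x + y * I))) y := fun y hy ↦
    hasDerivAt_log_comp_vertical (hg y hy) (hs y hy)
  have hcont : ContinuousOn (fun y : ℝ ↦ I * (deriv g (x + y * I) / g (x + y * I))) (Icc c d) := by
    intro y hy
    have h1 : ContinuousAt (fun y : ℝ ↦ (x : ℂ) + y * I) y := by fun_prop
    have h2 : ContinuousAt (deriv g) ((x : ℂ) + y * I) := (hg y hy).deriv.continuousAt
    have h3 : ContinuousAt g ((x : ℂ) + y * I) := (hg y hy).continuousAt
    exact (((h2.comp (f := fun y : ℝ ↦ (x : ℂ) + y * I) h1).div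
      (h3.comp (f := fun y : ℝ ↦ (x : ℂ) + y * I) h1)
      (slitPlane_ne_zero (hs y hy))).const_mul I).continuousWithinAt
  rw [← intervalIntegral.integral_const_mul]
  refine integral_eq_sub_of_hasDerivAt_of_le hcd ?_ (fun y hy ↦ hderiv y (Ioo_subset_Icc_self hy))
    (hcont.intervalIntegrable_of_Icc hcd)
  exact fun y hy ↦ (hderiv y hy).continuousAt.continuousWithinAt

/-- **Zero change of argument.** If `g` is analytic at every point of the boundary of the
rectangle `[a,b] × [c,d]` and takes values in the slit plane `ℂ ∖ (-∞,0]` there (for instance if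
`Re g > 0` on the boundary), then the boundary integral of `g'/g` (four-term convention:
bottom − top + i·right − i·left) vanishes: the principal `log g` is a primitive along the whole
boundary. [folklore] -/
theorem integral_boundary_rect_logDeriv_eq_zero_of_mem_slitPlane {g : ℂ → ℂ} (hab : a ≤ b)
    (hcd : c ≤ d)
    (hg_bot : ∀ x ∈ Icc a b, AnalyticAt ℂ g (x + c * I))
    (hg_top : ∀ x ∈ Icc a b, AnalyticAt ℂ g (x + d * I))
    (hg_left : ∀ y ∈ Icc c d, AnalyticAt ℂ g (a + y * I))
    (hg_right : ∀ y ∈ Icc c d, AnalyticAt ℂ g (b + y * I))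
    (hs_bot : ∀ x ∈ Icc a b, g (x + c * I) ∈ slitPlane)
    (hs_top : ∀ x ∈ Icc a b, g (x + d * I) ∈ slitPlane)
    (hs_left : ∀ y ∈ Icc c d, g (a + y * I) ∈ slitPlane)
    (hs_right : ∀ y ∈ Icc c d, g (b + y * I) ∈ slitPlane) :
    (∫ x : ℝ in a..b, deriv g (x + c * I) / g (x + c * I)) -
      (∫ x : ℝ in a..b, deriv g (x + d * I) / g (x + d * I)) +
      I * (∫ y : ℝ in c..d, deriv g (b + y * I) / g (b + y * I)) -
      I * (∫ y : ℝ in c..d, deriv g (a + y * I) / g (a + y * I)) = 0 := by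
  rw [integral_logDeriv_horizontal c hab hg_bot hs_bot, integral_logDeriv_horizontal d hab hg_top hs_top,
    integral_logDeriv_vertical b hcd hg_right hs_right, integral_logDeriv_vertical a hcd hg_left hs_left]
  ring

/-! ### The argument principle -/

/-- The four-term boundary integral of `F` over the rectangle `[a,b] × [c,d]`, in the convention of
Mathlib's `Complex.integral_boundary_rect_eq_zero_of_differentiableOn`
(bottom − top + i·right − i·left, i.e. the counter-clockwise contour integral when `a ≤ b`,
`c ≤ d`). [folklore] -/
def rectBoundaryIntegral (F : ℂ → ℂ) (a b c d : ℝ) : ℂ :=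
  (∫ x : ℝ in a..b, F (x + c * I)) - (∫ x : ℝ in a..b, F (x + d * I)) +
    I * (∫ y : ℝ in c..d, F (b + y * I)) - I * (∫ y : ℝ in c..d, F (a + y * I))

/-- Unfolding of `rectBoundaryIntegral`. [folklore] -/
lemma rectBoundaryIntegral_def (F : ℂ → ℂ) (a b c d : ℝ) :
    rectBoundaryIntegral F a b c d =
      (∫ x : ℝ in a..b, F (x + c * I)) - (∫ x : ℝ in a..b, F (x + d * I)) +
        I * (∫ y : ℝ in c..d, F (b + y * I)) - I * (∫ y : ℝ in c..d, F (a + y * I)) := rfl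

/-- A function continuous at every point of a horizontal segment is interval integrable along
it. [folklore] -/
lemma intervalIntegrable_of_continuousAt_horizontal {F : ℂ → ℂ} (y : ℝ) (hab : a ≤ b)
    (h : ∀ x ∈ Icc a b, ContinuousAt F (x + y * I)) :
    IntervalIntegrable (fun x : ℝ ↦ F (x + y * I)) volume a b := by
  apply ContinuousOn.intervalIntegrable
  rw [uIcc_of_le hab]
  intro x hx
  have h1 : ContinuousAt (fun x : ℝ ↦ (x : ℂ) + y * I) x := by fun_prop
  exact ((h x hx).comp (f := fun x : ℝ ↦ (x : ℂ) + y * I) h1).continuousWithinAt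

/-- A function continuous at every point of a vertical segment is interval integrable along
it. [folklore] -/
lemma intervalIntegrable_of_continuousAt_vertical {F : ℂ → ℂ} (x : ℝ) (hcd : c ≤ d)
    (h : ∀ y ∈ Icc c d, ContinuousAt F (x + y * I)) :
    IntervalIntegrable (fun y : ℝ ↦ F (x + y * I)) volume c d := by
  apply ContinuousOn.intervalIntegrable
  rw [uIcc_of_le hcd]
  intro y hy
  have h1 : ContinuousAt (fun y : ℝ ↦ (x : ℂ) + y * I) y := by fun_prop
  exact ((h y hy).comp (f := fun y : ℝ ↦ (x : ℂ) + y * I) h1).continuousWithinAt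

/-- Additivity of the boundary integral for integrands continuous at every boundary point.
[folklore] -/
lemma rectBoundaryIntegral_add {F G : ℂ → ℂ} (hab : a ≤ b) (hcd : c ≤ d)
    (hF_bot : ∀ x ∈ Icc a b, ContinuousAt F (x + c * I))
    (hF_top : ∀ x ∈ Icc a b, ContinuousAt F (x + d * I))
    (hF_left : ∀ y ∈ Icc c d, ContinuousAt F (a + y * I))
    (hF_right : ∀ y ∈ Icc c d, ContinuousAt F (b + y * I))
    (hG_bot : ∀ x ∈ Icc a b, ContinuousAt G (x + c * I))
    (hG_top : ∀ x ∈ Icc a b, ContinuousAt G (x + d * I))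
    (hG_left : ∀ y ∈ Icc c d, ContinuousAt G (a + y * I))
    (hG_right : ∀ y ∈ Icc c d, ContinuousAt G (b + y * I)) :
    rectBoundaryIntegral (fun z ↦ F z + G z) a b c d =
      rectBoundaryIntegral F a b c d + rectBoundaryIntegral G a b c d := by
  simp only [rectBoundaryIntegral]
  rw [integral_add (intervalIntegrable_of_continuousAt_horizontal c hab hF_bot)
      (intervalIntegrable_of_continuousAt_horizontal c hab hG_bot),
    integral_add (intervalIntegrable_of_continuousAt_horizontal d hab hF_top)
      (intervalIntegrable_of_continuousAt_horizontal d hab hG_top),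
    integral_add (intervalIntegrable_of_continuousAt_vertical b hcd hF_right)
      (intervalIntegrable_of_continuousAt_vertical b hcd hG_right),
    integral_add (intervalIntegrable_of_continuousAt_vertical a hcd hF_left)
      (intervalIntegrable_of_continuousAt_vertical a hcd hG_left)]
  ring

/-- Homogeneity of the boundary integral. [folklore] -/
lemma rectBoundaryIntegral_const_mul (F : ℂ → ℂ) (m : ℂ) (a b c d : ℝ) :
    rectBoundaryIntegral (fun z ↦ m * F z) a b c d = m * rectBoundaryIntegral F a b c d := by
  simp only [rectBoundaryIntegral, intervalIntegral.integral_const_mul]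
  ring

/-- The boundary integral only depends on the values on the boundary. [folklore] -/
lemma rectBoundaryIntegral_congr {F G : ℂ → ℂ} (hab : a ≤ b) (hcd : c ≤ d)
    (h_bot : ∀ x ∈ Icc a b, F (x + c * I) = G (x + c * I))
    (h_top : ∀ x ∈ Icc a b, F (x + d * I) = G (x + d * I))
    (h_left : ∀ y ∈ Icc c d, F (a + y * I) = G (a + y * I))
    (h_right : ∀ y ∈ Icc c d, F (b + y * I) = G (b + y * I)) :
    rectBoundaryIntegral F a b c d = rectBoundaryIntegral G a b c d := by
  simp only [rectBoundaryIntegral]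
  rw [intervalIntegral.integral_congr (fun x hx ↦ h_bot x (by rwa [uIcc_of_le hab] at hx)),
    intervalIntegral.integral_congr (fun x hx ↦ h_top x (by rwa [uIcc_of_le hab] at hx)),
    intervalIntegral.integral_congr (fun y hy ↦ h_right y (by rwa [uIcc_of_le hcd] at hy)),
    intervalIntegral.integral_congr (fun y hy ↦ h_left y (by rwa [uIcc_of_le hcd] at hy))]

/-- **Winding number of the rectangle**, restated: `∮_{∂R} m/(z-ρ) dz = 2πi·m` for `ρ` in the
open rectangle. [folklore] -/
lemma rectBoundaryIntegral_const_mul_inv_sub (m ρ : ℂ) (ha : a < ρ.re) (hb : ρ.re < b)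
    (hc : c < ρ.im) (hd : ρ.im < d) :
    rectBoundaryIntegral (fun z ↦ m * (z - ρ)⁻¹) a b c d = 2 * Real.pi * I * m := by
  rw [rectBoundaryIntegral_const_mul, rectBoundaryIntegral]
  have := integral_boundary_rect_inv_sub ρ ha hb hc hd
  rw [this]
  ring

/-- Cauchy–Goursat in the four-term convention: the boundary integral of a function complex
differentiable on the closed rectangle vanishes. [folklore] -/
lemma rectBoundaryIntegral_eq_zero_of_differentiableOn {F : ℂ → ℂ} (hab : a ≤ b) (hcd : c ≤ d)
    (hF : DifferentiableOn ℂ F (Icc a b ×ℂ Icc c d)) : rectBoundaryIntegral F a b c d = 0 := by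
  have h := Complex.integral_boundary_rect_eq_zero_of_differentiableOn F (a + c * I) (b + d * I)
    (by simpa [uIcc_of_le hab, uIcc_of_le hcd] using hF)
  simp only [add_re, ofReal_re, mul_re, I_re, mul_zero, ofReal_im, I_im, mul_one, sub_self,
    add_zero, add_im, mul_im, zero_add, smul_eq_mul] at h
  simpa [rectBoundaryIntegral] using h

/-- The closed rectangle `[a,b] × [c,d]` (`a ≤ b`, `c ≤ d`) is convex, hence preconnected. [folklore] -/
lemma isPreconnected_Icc_reProdIm (hab : a ≤ b) (hcd : c ≤ d) :
    IsPreconnected (Icc a b ×ℂ Icc c d) := by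
  have h := rectangle_eq_convexHull ((a : ℂ) + c * I) ((b : ℂ) + d * I)
  simp only [Rectangle, add_re, ofReal_re, mul_re, I_re, mul_zero, ofReal_im, I_im, mul_one,
    sub_self, add_zero, add_im, mul_im, zero_add, uIcc_of_le hab, uIcc_of_le hcd] at h
  rw [h]
  exact (convex_convexHull ℝ _).isPreconnected

/-- An analytic function on the closed rectangle `[a,b] × [c,d]` (`a ≤ b`, `c ≤ d`) which is
non-zero at one point of it has finite order at every point of it. [folklore] -/
lemma analyticOrderAt_ne_top_of_reProdIm {f : ℂ → ℂ} (hab : a ≤ b) (hcd : c ≤ d)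
    (hf : AnalyticOnNhd ℂ f (Icc a b ×ℂ Icc c d)) {w : ℂ} (hw : w ∈ Icc a b ×ℂ Icc c d)
    (hfw : f w ≠ 0) {z : ℂ} (hz : z ∈ Icc a b ×ℂ Icc c d) : analyticOrderAt f z ≠ ⊤ := by
  intro htop
  have h0 : f =ᶠ[𝓝 z] 0 := analyticOrderAt_eq_top.mp htop
  have := hf.eqOn_zero_of_preconnected_of_eventuallyEq_zero (isPreconnected_Icc_reProdIm hab hcd) hz h0
  exact hfw (this hw)

/-- An analytic function on the closed rectangle `[a,b] × [c,d]` (`a ≤ b`, `c ≤ d`) which is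
non-zero at one point of it is not identically zero near any point of it. [folklore] -/
lemma meromorphicOrderAt_ne_top_of_reProdIm {f : ℂ → ℂ} (hab : a ≤ b) (hcd : c ≤ d)
    (hf : AnalyticOnNhd ℂ f (Icc a b ×ℂ Icc c d)) {w : ℂ} (hw : w ∈ Icc a b ×ℂ Icc c d)
    (hfw : f w ≠ 0) {z : ℂ} (hz : z ∈ Icc a b ×ℂ Icc c d) : meromorphicOrderAt f z ≠ ⊤ := by
  rw [(hf z hz).meromorphicOrderAt_eq]
  have := analyticOrderAt_ne_top_of_reProdIm hab hcd hf hw hfw hz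
  cases h : analyticOrderAt f z with
  | top => exact absurd h this
  | coe n => simp

/-- **Finiteness of the zeros.** An analytic function on the closed rectangle `[a,b] × [c,d]`,
non-zero somewhere on it, has finitely many zeros in the open rectangle. [folklore] -/
theorem finite_zeros_reProdIm {f : ℂ → ℂ} (hab : a ≤ b) (hcd : c ≤ d)
    (hf : AnalyticOnNhd ℂ f (Icc a b ×ℂ Icc c d)) {w : ℂ} (hw : w ∈ Icc a b ×ℂ Icc c d)
    (hfw : f w ≠ 0) : {ρ : ℂ | f ρ = 0 ∧ ρ ∈ Ioo a b ×ℂ Ioo c d}.Finite := by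
  have hK : IsCompact (Icc a b ×ℂ Icc c d) := isCompact_Icc.reProdIm isCompact_Icc
  refine ((MeromorphicOn.divisor f (Icc a b ×ℂ Icc c d)).finiteSupport hK).subset ?_
  rintro ρ ⟨hρ0, hρ⟩
  have hρK : ρ ∈ Icc a b ×ℂ Icc c d := ⟨Ioo_subset_Icc_self hρ.1, Ioo_subset_Icc_self hρ.2⟩
  rw [Function.mem_support, hf.meromorphicOn.divisor_apply hρK]
  have hne := analyticOrderAt_ne_top_of_reProdIm hab hcd hf hw hfw hρK
  rw [(hf ρ hρK).meromorphicOrderAt_eq]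
  cases h : analyticOrderAt f ρ with
  | top => exact absurd h hne
  | coe n =>
    have hn : n ≠ 0 := by
      intro hn0
      rw [hn0] at h
      exact ((hf ρ hρK).analyticOrderAt_eq_zero.mp (by exact_mod_cast h)) hρ0
    simpa using hn

/-- Elementary identity used to log-differentiate `(z-ρ)^m · f₁`: `m w^{m-1} = w^m · (m w⁻¹)`
for `w ≠ 0` (both sides vanish for `m = 0`). [folklore] -/
private lemma natCast_mul_pow_pred (w : ℂ) (hw : w ≠ 0) (m : ℕ) :
    (m : ℂ) * w ^ (m - 1) = w ^ m * (m * w⁻¹) := by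
  cases m with
  | zero => simp
  | succ k =>
    rw [Nat.add_sub_cancel, pow_succ]
    field_simp

/-- **The argument principle on a rectangle**, inductive form. Let `f` be analytic at every point
of the closed rectangle `K = [a,b] × [c,d]` (`a < b`, `c < d`) and let `S` be a finite subset of the
open rectangle containing all zeros of `f` in `K` (so `f ≠ 0` on `∂K`). Then
`∮_{∂K} f'/f = 2πi · Σ_{ρ ∈ S} m(ρ)`, `m(ρ) = meromorphicOrderAt f ρ` (which is `0` at the points
of `S` where `f ≠ 0`). Proof by induction on `S`: divide out `(z-ρ)^{m(ρ)}` at one point,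
`f'/f = m(ρ)/(z-ρ) + f₁'/f₁` on `∂K`, and use `∮ dz/(z-ρ) = 2πi`
(`integral_boundary_rect_inv_sub`) and Cauchy–Goursat for the zero-free case.
[cite: Conway1978, Ch. V Thm. 3.4] -/
theorem rectBoundaryIntegral_logDeriv_eq_sum (hab : a < b) (hcd : c < d) (S : Finset ℂ) :
    ∀ f : ℂ → ℂ, AnalyticOnNhd ℂ f (Icc a b ×ℂ Icc c d) →
      (∀ z ∈ Icc a b ×ℂ Icc c d, f z = 0 → z ∈ S) → ((S : Set ℂ) ⊆ Ioo a b ×ℂ Ioo c d) →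
      rectBoundaryIntegral (fun z ↦ deriv f z / f z) a b c d =
        2 * Real.pi * I * ∑ ρ ∈ S, ((meromorphicOrderAt f ρ).untop₀ : ℂ) := by
  classical
  induction S using Finset.induction_on with
  | empty =>
    intro f hf hzero _
    have hne : ∀ z ∈ Icc a b ×ℂ Icc c d, f z ≠ 0 := fun z hz h0 ↦ by simpa using hzero z hz h0
    have hd : DifferentiableOn ℂ (fun z ↦ deriv f z / f z) (Icc a b ×ℂ Icc c d) := by
      intro z hz
      exact (((hf z hz).deriv.differentiableAt).div (hf z hz).differentiableAt
        (hne z hz)).differentiableWithinAt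
    rw [rectBoundaryIntegral_eq_zero_of_differentiableOn hab.le hcd.le hd]
    simp
  | insert ρ S' hρS' ih =>
    intro f hf hzero hsub
    -- location of ρ
    have hρS : ρ ∈ Ioo a b ×ℂ Ioo c d := hsub (Finset.mem_coe.2 (Finset.mem_insert_self ρ S'))
    have hρK : ρ ∈ Icc a b ×ℂ Icc c d := ⟨Ioo_subset_Icc_self hρS.1, Ioo_subset_Icc_self hρS.2⟩
    -- f is non-zero off the open rectangle, in particular at the corner a + ci
    have hbd : ∀ z ∈ Icc a b ×ℂ Icc c d, z ∉ Ioo a b ×ℂ Ioo c d → f z ≠ 0 :=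
      fun z hz hnot h0 ↦ hnot (hsub (Finset.mem_coe.2 (hzero z hz h0)))
    have hcorner : ((a : ℂ) + c * I) ∈ Icc a b ×ℂ Icc c d :=
      ⟨by simpa using hab.le, by simpa using hcd.le⟩
    have hcorner' : ((a : ℂ) + c * I) ∉ Ioo a b ×ℂ Ioo c d := by
      intro h
      have := h.1.1
      simp at this
    have hw : f (a + c * I) ≠ 0 := hbd _ hcorner hcorner'
    -- local factorisation at ρ
    have hne_top : analyticOrderAt f ρ ≠ ⊤ :=
      analyticOrderAt_ne_top_of_reProdIm hab.le hcd.le hf hcorner hw hρK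
    obtain ⟨g, hg_an, hg_ne, hfg⟩ := (hf ρ hρK).analyticOrderAt_ne_top.mp hne_top
    set m : ℕ := analyticOrderNatAt f ρ with hm
    -- the quotient f₁ = f/(z-ρ)^m, extended by g ρ at ρ
    set f₁ : ℂ → ℂ := fun z ↦ if z = ρ then g ρ else f z / (z - ρ) ^ m with hf₁_def
    have hf₁_of_ne : ∀ z, z ≠ ρ → f₁ z = f z / (z - ρ) ^ m := fun z hz ↦ by
      simp [hf₁_def, hz]
    have hf_eq : ∀ z, z ≠ ρ → f z = (z - ρ) ^ m * f₁ z := fun z hz ↦ by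
      rw [hf₁_of_ne z hz, mul_div_cancel₀ _ (pow_ne_zero _ (sub_ne_zero.2 hz))]
    have hf₁ρ : f₁ =ᶠ[𝓝 ρ] g := by
      filter_upwards [hfg] with z hz
      by_cases hzρ : z = ρ
      · subst hzρ; simp [hf₁_def]
      · rw [hf₁_of_ne z hzρ, hz, smul_eq_mul, mul_div_cancel_left₀ _
          (pow_ne_zero _ (sub_ne_zero.2 hzρ))]
    -- f agrees with (z-ρ)^m f₁ near every point other than ρ
    have hf_ev : ∀ z, z ≠ ρ → f =ᶠ[𝓝 z] fun w ↦ (w - ρ) ^ m * f₁ w := fun z hz ↦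
      (isOpen_ne.eventually_mem hz).mono fun w hw ↦ hf_eq w hw
    -- analyticity of f₁ on K
    have hf₁_an : AnalyticOnNhd ℂ f₁ (Icc a b ×ℂ Icc c d) := by
      intro z hz
      by_cases hzρ : z = ρ
      · subst hzρ
        exact hg_an.congr hf₁ρ.symm
      · have h1 : AnalyticAt ℂ (fun w ↦ f w / (w - ρ) ^ m) z :=
          (hf z hz).div ((analyticAt_id.sub analyticAt_const).pow m)
            (pow_ne_zero _ (sub_ne_zero.2 hzρ))
        refine h1.congr ?_
        exact (isOpen_ne.eventually_mem hzρ).mono fun w hw ↦ (hf₁_of_ne w hw).symm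
    -- zeros of f₁ in K lie in S'
    have hzero' : ∀ z ∈ Icc a b ×ℂ Icc c d, f₁ z = 0 → z ∈ S' := by
      intro z hz h0
      by_cases hzρ : z = ρ
      · subst hzρ
        exact absurd (by simpa [hf₁_def] using h0) hg_ne
      · have hfz : f z = 0 := by rw [hf_eq z hzρ, h0, mul_zero]
        have := hzero z hz hfz
        rw [Finset.mem_insert] at this
        exact this.resolve_left hzρ
    have hsub' : ((S' : Set ℂ)) ⊆ Ioo a b ×ℂ Ioo c d :=
      (Finset.coe_subset.2 (Finset.subset_insert ρ S')).trans hsub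
    have hIH := ih f₁ hf₁_an hzero' hsub'
    -- the logarithmic derivative splits: f'/f = m/(z-ρ) + f₁'/f₁ where f ≠ 0, z ≠ ρ, z ∈ K
    have hsplit : ∀ z ∈ Icc a b ×ℂ Icc c d, z ≠ ρ → f z ≠ 0 →
        deriv f z / f z = (m : ℂ) * (z - ρ)⁻¹ + deriv f₁ z / f₁ z := by
      intro z hz hzρ hfz
      have hzρ' : z - ρ ≠ 0 := sub_ne_zero.2 hzρ
      have hf₁z : f₁ z ≠ 0 := by
        intro h0; exact hfz (by rw [hf_eq z hzρ, h0, mul_zero])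
      have hderiv : deriv f z = (m : ℂ) * (z - ρ) ^ (m - 1) * f₁ z + (z - ρ) ^ m * deriv f₁ z := by
        rw [(hf_ev z hzρ).deriv_eq]
        have h1 : HasDerivAt (fun w : ℂ ↦ (w - ρ) ^ m) ((m : ℂ) * (z - ρ) ^ (m - 1) * 1) z :=
          ((hasDerivAt_id z).sub_const ρ).pow m
        have h2 : HasDerivAt f₁ (deriv f₁ z) z := (hf₁_an z hz).differentiableAt.hasDerivAt
        have h3 : HasDerivAt (fun w : ℂ ↦ (w - ρ) ^ m * f₁ w)
            ((m : ℂ) * (z - ρ) ^ (m - 1) * 1 * f₁ z + (z - ρ) ^ m * deriv f₁ z) z := h1.mul h2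
        rw [h3.deriv]
        ring
      rw [hderiv, natCast_mul_pow_pred (z - ρ) hzρ' m, hf_eq z hzρ]
      field_simp
    -- boundary points are in K, differ from ρ, and f ≠ 0 there
    have hbot_mem : ∀ x ∈ Icc a b, ((x : ℂ) + c * I) ∈ Icc a b ×ℂ Icc c d := fun x hx ↦
      ⟨by simpa using hx, by simpa using hcd.le⟩
    have htop_mem : ∀ x ∈ Icc a b, ((x : ℂ) + d * I) ∈ Icc a b ×ℂ Icc c d := fun x hx ↦
      ⟨by simpa using hx, by simpa using hcd.le⟩
    have hleft_mem : ∀ y ∈ Icc c d, ((a : ℂ) + y * I) ∈ Icc a b ×ℂ Icc c d := fun y hy ↦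
      ⟨by simpa using hab.le, by simpa using hy⟩
    have hright_mem : ∀ y ∈ Icc c d, ((b : ℂ) + y * I) ∈ Icc a b ×ℂ Icc c d := fun y hy ↦
      ⟨by simpa using hab.le, by simpa using hy⟩
    have hbot_not : ∀ x ∈ Icc a b, ((x : ℂ) + c * I) ∉ Ioo a b ×ℂ Ioo c d := fun x _ h ↦ by
      have := h.2.1; simp at this
    have htop_not : ∀ x ∈ Icc a b, ((x : ℂ) + d * I) ∉ Ioo a b ×ℂ Ioo c d := fun x _ h ↦ by
      have := h.2.2; simp at this
    have hleft_not : ∀ y ∈ Icc c d, ((a : ℂ) + y * I) ∉ Ioo a b ×ℂ Ioo c d := fun y _ h ↦ by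
      have := h.1.1; simp at this
    have hright_not : ∀ y ∈ Icc c d, ((b : ℂ) + y * I) ∉ Ioo a b ×ℂ Ioo c d := fun y _ h ↦ by
      have := h.1.2; simp at this
    have hne_of_not : ∀ z, z ∉ Ioo a b ×ℂ Ioo c d → z ≠ ρ := fun z hz h ↦ hz (h ▸ hρS)
    -- continuity of the two summands at boundary points
    have hcont_inv : ∀ z, z ≠ ρ → ContinuousAt (fun w : ℂ ↦ (m : ℂ) * (w - ρ)⁻¹) z := by
      intro z hz
      have : ContinuousAt (fun w : ℂ ↦ (w - ρ)⁻¹) z :=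
        (continuousAt_id.sub continuousAt_const).inv₀ (sub_ne_zero.2 hz)
      exact this.const_mul _
    have hcont_f₁ : ∀ z ∈ Icc a b ×ℂ Icc c d, z ≠ ρ → f z ≠ 0 →
        ContinuousAt (fun w ↦ deriv f₁ w / f₁ w) z := by
      intro z hz hzρ hfz
      have hf₁z : f₁ z ≠ 0 := by
        intro h0; exact hfz (by rw [hf_eq z hzρ, h0, mul_zero])
      exact ((hf₁_an z hz).deriv.continuousAt).div (hf₁_an z hz).continuousAt hf₁z
    -- rewrite the boundary integral of f'/f
    have step1 : rectBoundaryIntegral (fun z ↦ deriv f z / f z) a b c d =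
        rectBoundaryIntegral (fun z ↦ (m : ℂ) * (z - ρ)⁻¹ + deriv f₁ z / f₁ z) a b c d := by
      refine rectBoundaryIntegral_congr hab.le hcd.le ?_ ?_ ?_ ?_
      · exact fun x hx ↦ hsplit _ (hbot_mem x hx) (hne_of_not _ (hbot_not x hx))
          (hbd _ (hbot_mem x hx) (hbot_not x hx))
      · exact fun x hx ↦ hsplit _ (htop_mem x hx) (hne_of_not _ (htop_not x hx))
          (hbd _ (htop_mem x hx) (htop_not x hx))
      · exact fun y hy ↦ hsplit _ (hleft_mem y hy) (hne_of_not _ (hleft_not y hy))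
          (hbd _ (hleft_mem y hy) (hleft_not y hy))
      · exact fun y hy ↦ hsplit _ (hright_mem y hy) (hne_of_not _ (hright_not y hy))
          (hbd _ (hright_mem y hy) (hright_not y hy))
    have step2 : rectBoundaryIntegral (fun z ↦ (m : ℂ) * (z - ρ)⁻¹ + deriv f₁ z / f₁ z) a b c d =
        rectBoundaryIntegral (fun z ↦ (m : ℂ) * (z - ρ)⁻¹) a b c d +
          rectBoundaryIntegral (fun z ↦ deriv f₁ z / f₁ z) a b c d := by
      refine rectBoundaryIntegral_add hab.le hcd.le ?_ ?_ ?_ ?_ ?_ ?_ ?_ ?_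
      · exact fun x hx ↦ hcont_inv _ (hne_of_not _ (hbot_not x hx))
      · exact fun x hx ↦ hcont_inv _ (hne_of_not _ (htop_not x hx))
      · exact fun y hy ↦ hcont_inv _ (hne_of_not _ (hleft_not y hy))
      · exact fun y hy ↦ hcont_inv _ (hne_of_not _ (hright_not y hy))
      · exact fun x hx ↦ hcont_f₁ _ (hbot_mem x hx) (hne_of_not _ (hbot_not x hx))
          (hbd _ (hbot_mem x hx) (hbot_not x hx))
      · exact fun x hx ↦ hcont_f₁ _ (htop_mem x hx) (hne_of_not _ (htop_not x hx))
          (hbd _ (htop_mem x hx) (htop_not x hx))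
      · exact fun y hy ↦ hcont_f₁ _ (hleft_mem y hy) (hne_of_not _ (hleft_not y hy))
          (hbd _ (hleft_mem y hy) (hleft_not y hy))
      · exact fun y hy ↦ hcont_f₁ _ (hright_mem y hy) (hne_of_not _ (hright_not y hy))
          (hbd _ (hright_mem y hy) (hright_not y hy))
    have step3 : rectBoundaryIntegral (fun z ↦ (m : ℂ) * (z - ρ)⁻¹) a b c d = 2 * Real.pi * I * m :=
      rectBoundaryIntegral_const_mul_inv_sub (m : ℂ) ρ hρS.1.1 hρS.1.2 hρS.2.1 hρS.2.2
    -- orders: at ρ the order of f is m; elsewhere on S' the orders of f and f₁ agree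
    have horder_ρ : ((meromorphicOrderAt f ρ).untop₀ : ℂ) = m := by
      rw [(hf ρ hρK).meromorphicOrderAt_eq, ← Nat.cast_analyticOrderNatAt hne_top]
      simp [hm]
    have horder_S' : ∀ ρ' ∈ S', ((meromorphicOrderAt f ρ').untop₀ : ℂ) =
        ((meromorphicOrderAt f₁ ρ').untop₀ : ℂ) := by
      intro ρ' hρ'
      have hne : ρ' ≠ ρ := fun h ↦ hρS' (h ▸ hρ')
      have hρ'K : ρ' ∈ Icc a b ×ℂ Icc c d := by
        have := hsub' (Finset.mem_coe.2 hρ')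
        exact ⟨Ioo_subset_Icc_self this.1, Ioo_subset_Icc_self this.2⟩
      have h1 : meromorphicOrderAt f ρ' = meromorphicOrderAt (fun w ↦ (w - ρ) ^ m * f₁ w) ρ' :=
        meromorphicOrderAt_congr ((hf_ev ρ' hne).filter_mono nhdsWithin_le_nhds)
      have hpow_an : AnalyticAt ℂ (fun w : ℂ ↦ (w - ρ) ^ m) ρ' :=
        (analyticAt_id.sub analyticAt_const).pow m
      have h2 : meromorphicOrderAt (fun w ↦ (w - ρ) ^ m * f₁ w) ρ' =
          meromorphicOrderAt (fun w : ℂ ↦ (w - ρ) ^ m) ρ' + meromorphicOrderAt f₁ ρ' :=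
        fun_meromorphicOrderAt_mul hpow_an.meromorphicAt (hf₁_an ρ' hρ'K).meromorphicAt
      have h3 : meromorphicOrderAt (fun w : ℂ ↦ (w - ρ) ^ m) ρ' = 0 := by
        rw [hpow_an.meromorphicOrderAt_eq,
          (hpow_an.analyticOrderAt_eq_zero.2 (pow_ne_zero _ (sub_ne_zero.2 hne)))]
        simp
      rw [h1, h2, h3, zero_add]
    -- assemble
    rw [step1, step2, step3, hIH, Finset.sum_insert hρS', horder_ρ,
      Finset.sum_congr rfl horder_S']
    ring

/-- **The argument principle on a rectangle.** Let `f` be analytic at every point of the closed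
rectangle `R = [a,b] × [c,d]` (`a < b`, `c < d`) and non-zero on its four edges. Then, in the
four-term boundary convention (bottom − top + i·right − i·left),
`∮_{∂R} f'(z)/f(z) dz = 2πi · Σ_{ρ ∈ R°, f(ρ) = 0} m(ρ)`, where `m(ρ) = meromorphicOrderAt f ρ` is
the multiplicity of the zero `ρ` (the sum is finite, `finite_zeros_reProdIm`).
(Conway 1978, V.3.4 with `γ = ∂R`, whose winding number about interior points is `1`,
`integral_boundary_rect_inv_sub`.) [cite: Conway1978, Ch. V Thm. 3.4] -/
theorem integral_boundary_rect_logDeriv {f : ℂ → ℂ} (hab : a < b) (hcd : c < d)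
    (hf : AnalyticOnNhd ℂ f (Icc a b ×ℂ Icc c d))
    (h_bot : ∀ x ∈ Icc a b, f (x + c * I) ≠ 0) (h_top : ∀ x ∈ Icc a b, f (x + d * I) ≠ 0)
    (h_left : ∀ y ∈ Icc c d, f (a + y * I) ≠ 0) (h_right : ∀ y ∈ Icc c d, f (b + y * I) ≠ 0) :
    (∫ x : ℝ in a..b, deriv f (x + c * I) / f (x + c * I)) -
      (∫ x : ℝ in a..b, deriv f (x + d * I) / f (x + d * I)) +
      I * (∫ y : ℝ in c..d, deriv f (b + y * I) / f (b + y * I)) -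
      I * (∫ y : ℝ in c..d, deriv f (a + y * I) / f (a + y * I)) =
      2 * Real.pi * I * ∑ᶠ ρ ∈ {ρ : ℂ | f ρ = 0 ∧ ρ ∈ Ioo a b ×ℂ Ioo c d},
        ((meromorphicOrderAt f ρ).untop₀ : ℂ) := by
  have hcorner : ((a : ℂ) + c * I) ∈ Icc a b ×ℂ Icc c d :=
    ⟨by simpa using hab.le, by simpa using hcd.le⟩
  have hw : f (a + c * I) ≠ 0 := h_bot a ⟨le_rfl, hab.le⟩
  have hfin := finite_zeros_reProdIm hab.le hcd.le hf hcorner hw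
  -- every zero in the closed rectangle is in the open rectangle
  have hzero : ∀ z ∈ Icc a b ×ℂ Icc c d, f z = 0 → z ∈ hfin.toFinset := by
    intro z hz h0
    rw [Set.Finite.mem_toFinset]
    refine ⟨h0, ?_⟩
    obtain ⟨⟨hza, hzb⟩, ⟨hzc, hzd⟩⟩ := hz
    have hz_eq : z = (z.re : ℂ) + (z.im : ℂ) * I := (re_add_im z).symm
    rcases hza.eq_or_lt with h | hza'
    · exact absurd h0 (by rw [hz_eq, ← h]; exact h_left z.im ⟨hzc, hzd⟩)
    rcases hzb.eq_or_lt with h | hzb'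
    · exact absurd h0 (by rw [hz_eq, h]; exact h_right z.im ⟨hzc, hzd⟩)
    rcases hzc.eq_or_lt with h | hzc'
    · exact absurd h0 (by rw [hz_eq, ← h]; exact h_bot z.re ⟨hza, hzb⟩)
    rcases hzd.eq_or_lt with h | hzd'
    · exact absurd h0 (by rw [hz_eq, h]; exact h_top z.re ⟨hza, hzb⟩)
    exact ⟨⟨hza', hzb'⟩, ⟨hzc', hzd'⟩⟩
  have hsub : ((hfin.toFinset : Set ℂ)) ⊆ Ioo a b ×ℂ Ioo c d := by
    intro z hz
    rw [Set.Finite.coe_toFinset] at hz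
    exact hz.2
  have := rectBoundaryIntegral_logDeriv_eq_sum hab hcd hfin.toFinset f hf hzero hsub
  rw [rectBoundaryIntegral] at this
  rw [this, finsum_mem_eq_finite_toFinset_sum _ hfin]

/-- **Zero change of argument in a half-plane.** If `g` is analytic at every boundary point of
`[a,b] × [c,d]` and `Re g < 0` on the boundary, then `∮_{∂R} g'/g = 0` (apply
`integral_boundary_rect_logDeriv_eq_zero_of_mem_slitPlane` to `-g`). This is the form used by
Levinson–Montgomery 1974, §2 ("Re ζ'/ζ < 0 and so the change in arg ζ'/ζ is 0 on the contour").
[folklore] -/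
theorem integral_boundary_rect_logDeriv_eq_zero_of_re_neg {g : ℂ → ℂ} (hab : a ≤ b)
    (hcd : c ≤ d)
    (hg_bot : ∀ x ∈ Icc a b, AnalyticAt ℂ g (x + c * I))
    (hg_top : ∀ x ∈ Icc a b, AnalyticAt ℂ g (x + d * I))
    (hg_left : ∀ y ∈ Icc c d, AnalyticAt ℂ g (a + y * I))
    (hg_right : ∀ y ∈ Icc c d, AnalyticAt ℂ g (b + y * I))
    (hs_bot : ∀ x ∈ Icc a b, (g (x + c * I)).re < 0)
    (hs_top : ∀ x ∈ Icc a b, (g (x + d * I)).re < 0)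
    (hs_left : ∀ y ∈ Icc c d, (g (a + y * I)).re < 0)
    (hs_right : ∀ y ∈ Icc c d, (g (b + y * I)).re < 0) :
    (∫ x : ℝ in a..b, deriv g (x + c * I) / g (x + c * I)) -
      (∫ x : ℝ in a..b, deriv g (x + d * I) / g (x + d * I)) +
      I * (∫ y : ℝ in c..d, deriv g (b + y * I) / g (b + y * I)) -
      I * (∫ y : ℝ in c..d, deriv g (a + y * I) / g (a + y * I)) = 0 := by
  have key : ∀ z, AnalyticAt ℂ g z → deriv (fun w ↦ -g w) z / (-g z) = deriv g z / g z := by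
    intro z hz
    rw [deriv.fun_neg, neg_div_neg_eq]
  have hslit : ∀ z, (g z).re < 0 → -g z ∈ slitPlane := fun z hz ↦
    Or.inl (by simpa using hz)
  have h := integral_boundary_rect_logDeriv_eq_zero_of_mem_slitPlane (g := fun w ↦ -g w) hab hcd
    (fun x hx ↦ (hg_bot x hx).neg) (fun x hx ↦ (hg_top x hx).neg)
    (fun y hy ↦ (hg_left y hy).neg) (fun y hy ↦ (hg_right y hy).neg)
    (fun x hx ↦ hslit _ (hs_bot x hx)) (fun x hx ↦ hslit _ (hs_top x hx))
    (fun y hy ↦ hslit _ (hs_left y hy)) (fun y hy ↦ hslit _ (hs_right y hy))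
  rw [intervalIntegral.integral_congr (fun x hx ↦ key _ (hg_bot x (by rwa [uIcc_of_le hab] at hx))),
    intervalIntegral.integral_congr (fun x hx ↦ key _ (hg_top x (by rwa [uIcc_of_le hab] at hx))),
    intervalIntegral.integral_congr (fun y hy ↦ key _ (hg_right y (by rwa [uIcc_of_le hcd] at hy))),
    intervalIntegral.integral_congr (fun y hy ↦ key _ (hg_left y (by rwa [uIcc_of_le hcd] at hy)))]
    at h
  exact h

end Literature.Analysis.Complex

end
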